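import Summits.HubbardSuperconductivity.HubbardSuperconductivity.Theorems.AnisotropyChordTransferFibre3NuRange
import Summits.HubbardSuperconductivity.HubbardSuperconductivity.Theorems.AnisotropyChordTransferFibre3AssemblyHole2

/-!
# Route `AnisotropyChord` / H0 rotor rung: the β-free cruxes and the regime hypothesis RESTRICTED TO THE a-priori `ν`-WINDOW

Glue for the FIN / Level-2 producers of the GM₃ ∀L certificate (LEVEL2-SPEC §2/§4: the certificate is evaluated on
`λ`-cells `λ₂ = νθ²`, `ν ∈ (0, ν_max]`).  By `…Fibre3NuRange` every ground profile has `λ₂ ≤ .0982·θ²` (`L ≥ 7`) and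
`λ₂ ≤ .0513·θ²` (`L ≥ 31`), `θ = 2π/L`; so each «∀ ground profile» hypothesis of the assembly (`TrialGapAbs`, `LowShellGFormAbs`,
`OffPoleTailAbs`, and the regime clause `0 ≤ mHole ∧ side condition` of `gm3_of_hole2`) only has to be CERTIFIED ON THE WINDOW
`0 < λ₂ ≤ ν_max θ²`:
* `forall_ground_of_window_7` / `_31`: the generic reduction for any predicate of `(λ₂, f)`;
* `trialGapAbs_of_window`, `lowShellGFormAbs_of_window`, `offPoleTailAbs_of_window` (`L ≥ 7`, window `.0982`) and the `L ≥ 31`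
  versions (`…_of_window_31`, window `.0513`);
* ★ `gm3_of_hole2_window`: `gm3_of_hole2` with the regime clause asked only on the window (`L ≥ 31`, `0 < Δ < 1`).
Prover seat `hubbard-h0-rotor-p1` g24; helper for stmt-HubbardSuperconductivity-19089 (`--supports`).
-/

set_option linter.dupNamespace false
set_option autoImplicit false

noncomputable section

open scoped BigOperators
open Complex

namespace Summit.HubbardSuperconductivity.HubbardSuperconductivity.Theorems.AnisotropyChord.Transfer.Fibre3

variable (L : ℕ) [NeZero L]

/-! ## The generic reduction -/

/-- ★ a «∀ ground profile» statement follows from its restriction to the window `0 < λ₂ ≤ .0982·θ²` (`L ≥ 7`, `0 ≤ Δ < 1`). [folklore] -/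
theorem forall_ground_of_window_7 (hL : 7 ≤ L) {Δ : ℝ} (hΔ0 : 0 ≤ Δ) (hΔ1 : Δ < 1) (P : ℝ → (Tor L → ℝ) → Prop)
    (h : ∀ lam2 : ℝ, ∀ f : Tor L → ℝ, IsGroundTwoMagnon L Δ lam2 f →
      0 < lam2 → lam2 ≤ 0.0982 * (2 * Real.pi / L) ^ 2 → P lam2 f) :
    ∀ lam2 : ℝ, ∀ f : Tor L → ℝ, IsGroundTwoMagnon L Δ lam2 f → P lam2 f :=
  fun lam2 f hf => h lam2 f hf (lam2_pos L (by omega) hΔ1 hf.1) (nu_le_of_ge_7 L hL hΔ0 hf)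

/-- ★ the same with the sharper window `0 < λ₂ ≤ .0513·θ²` for `L ≥ 31`. [folklore] -/
theorem forall_ground_of_window_31 (hL : 31 ≤ L) {Δ : ℝ} (hΔ0 : 0 ≤ Δ) (hΔ1 : Δ < 1) (P : ℝ → (Tor L → ℝ) → Prop)
    (h : ∀ lam2 : ℝ, ∀ f : Tor L → ℝ, IsGroundTwoMagnon L Δ lam2 f →
      0 < lam2 → lam2 ≤ 0.0513 * (2 * Real.pi / L) ^ 2 → P lam2 f) :
    ∀ lam2 : ℝ, ∀ f : Tor L → ℝ, IsGroundTwoMagnon L Δ lam2 f → P lam2 f :=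
  fun lam2 f hf => h lam2 f hf (lam2_pos L (by omega) hΔ1 hf.1) (nu_le_of_ge_31 L hL hΔ0 hf)

/-! ## The three β-free cruxes on the window -/

/-- (KT-1″) on the window suffices (`L ≥ 7`). [folklore] -/
theorem trialGapAbs_of_window (hL : 7 ≤ L) {Δ c : ℝ} (hΔ0 : 0 ≤ Δ) (hΔ1 : Δ < 1)
    (h : ∀ lam2 : ℝ, ∀ f : Tor L → ℝ, IsGroundTwoMagnon L Δ lam2 f →
      0 < lam2 → lam2 ≤ 0.0982 * (2 * Real.pi / L) ^ 2 → c * Uunit L Δ f ≤ trialGapN1 L Δ f) :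
    TrialGapAbs L Δ c :=
  forall_ground_of_window_7 L hL hΔ0 hΔ1 (fun _ f => c * Uunit L Δ f ≤ trialGapN1 L Δ f) h

/-- (KT-2a″) on the window suffices (`L ≥ 7`). [folklore] -/
theorem lowShellGFormAbs_of_window (hL : 7 ≤ L) {Δ a : ℝ} (hΔ0 : 0 ≤ Δ) (hΔ1 : Δ < 1)
    (h : ∀ lam2 : ℝ, ∀ f : Tor L → ℝ, IsGroundTwoMagnon L Δ lam2 f →
      0 < lam2 → lam2 ≤ 0.0982 * (2 * Real.pi / L) ^ 2 → lowGForm L Δ f ≤ a * etaEff L lam2 * Uunit L Δ f) :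
    LowShellGFormAbs L Δ a :=
  forall_ground_of_window_7 L hL hΔ0 hΔ1 (fun lam2 f => lowGForm L Δ f ≤ a * etaEff L lam2 * Uunit L Δ f) h

/-- (KT-2b″) on the window suffices (`L ≥ 7`). [folklore] -/
theorem offPoleTailAbs_of_window (hL : 7 ≤ L) {Δ b : ℝ} (hΔ0 : 0 ≤ Δ) (hΔ1 : Δ < 1)
    (h : ∀ lam2 : ℝ, ∀ f : Tor L → ℝ, IsGroundTwoMagnon L Δ lam2 f →
      0 < lam2 → lam2 ≤ 0.0982 * (2 * Real.pi / L) ^ 2 →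
        (ip L (resid L Δ f) (resid L Δ f)).re - polePart L Δ f - lowNormPart L Δ f
          ≤ b * etaEff L lam2 * (2 * eps1 L - Tplus L Δ f) * Uunit L Δ f) :
    OffPoleTailAbs L Δ b :=
  forall_ground_of_window_7 L hL hΔ0 hΔ1
    (fun lam2 f => (ip L (resid L Δ f) (resid L Δ f)).re - polePart L Δ f - lowNormPart L Δ f
      ≤ b * etaEff L lam2 * (2 * eps1 L - Tplus L Δ f) * Uunit L Δ f) h

/-- (KT-1″) on the sharp window suffices (`L ≥ 31`). [folklore] -/
theorem trialGapAbs_of_window_31 (hL : 31 ≤ L) {Δ c : ℝ} (hΔ0 : 0 ≤ Δ) (hΔ1 : Δ < 1)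
    (h : ∀ lam2 : ℝ, ∀ f : Tor L → ℝ, IsGroundTwoMagnon L Δ lam2 f →
      0 < lam2 → lam2 ≤ 0.0513 * (2 * Real.pi / L) ^ 2 → c * Uunit L Δ f ≤ trialGapN1 L Δ f) :
    TrialGapAbs L Δ c :=
  forall_ground_of_window_31 L hL hΔ0 hΔ1 (fun _ f => c * Uunit L Δ f ≤ trialGapN1 L Δ f) h

/-- (KT-2a″) on the sharp window suffices (`L ≥ 31`). [folklore] -/
theorem lowShellGFormAbs_of_window_31 (hL : 31 ≤ L) {Δ a : ℝ} (hΔ0 : 0 ≤ Δ) (hΔ1 : Δ < 1)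
    (h : ∀ lam2 : ℝ, ∀ f : Tor L → ℝ, IsGroundTwoMagnon L Δ lam2 f →
      0 < lam2 → lam2 ≤ 0.0513 * (2 * Real.pi / L) ^ 2 → lowGForm L Δ f ≤ a * etaEff L lam2 * Uunit L Δ f) :
    LowShellGFormAbs L Δ a :=
  forall_ground_of_window_31 L hL hΔ0 hΔ1 (fun lam2 f => lowGForm L Δ f ≤ a * etaEff L lam2 * Uunit L Δ f) h

/-- (KT-2b″) on the sharp window suffices (`L ≥ 31`). [folklore] -/
theorem offPoleTailAbs_of_window_31 (hL : 31 ≤ L) {Δ b : ℝ} (hΔ0 : 0 ≤ Δ) (hΔ1 : Δ < 1)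
    (h : ∀ lam2 : ℝ, ∀ f : Tor L → ℝ, IsGroundTwoMagnon L Δ lam2 f →
      0 < lam2 → lam2 ≤ 0.0513 * (2 * Real.pi / L) ^ 2 →
        (ip L (resid L Δ f) (resid L Δ f)).re - polePart L Δ f - lowNormPart L Δ f
          ≤ b * etaEff L lam2 * (2 * eps1 L - Tplus L Δ f) * Uunit L Δ f) :
    OffPoleTailAbs L Δ b :=
  forall_ground_of_window_31 L hL hΔ0 hΔ1
    (fun lam2 f => (ip L (resid L Δ f) (resid L Δ f)).re - polePart L Δ f - lowNormPart L Δ f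
      ≤ b * etaEff L lam2 * (2 * eps1 L - Tplus L Δ f) * Uunit L Δ f) h

/-! ## The assembly with the regime clause on the window -/

/-- ★ **`gm3_of_hole2` with every «∀ ground profile» input restricted to the window `0 < λ₂ ≤ .0513·θ²`** (`L ≥ 31`, `0 < Δ < 1`):
HOLE₂(.75) + the three windowed cruxes + the windowed regime clause ⇒ `GM3Fibre L Δ`. [folklore] -/
theorem gm3_of_hole2_window (hL : 31 ≤ L) {Δ : ℝ} (hΔ0 : 0 < Δ) (hΔ1 : Δ < 1) (c a b : ℝ)
    (hH2 : TwoHoleGap L (3 / 4 * eps1 L))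
    (hreg : ∀ lam2 : ℝ, ∀ f : Tor L → ℝ, IsGroundTwoMagnon L Δ lam2 f →
      0 < lam2 → lam2 ≤ 0.0513 * (2 * Real.pi / L) ^ 2 →
        0 ≤ mHole L Δ f ∧ facMI L Δ f * etaEff L lam2 * (a + b / (2 + Real.cos (2 * Real.pi / L))) < c)
    (hKT1 : ∀ lam2 : ℝ, ∀ f : Tor L → ℝ, IsGroundTwoMagnon L Δ lam2 f →
      0 < lam2 → lam2 ≤ 0.0513 * (2 * Real.pi / L) ^ 2 → c * Uunit L Δ f ≤ trialGapN1 L Δ f)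
    (hKT2a : ∀ lam2 : ℝ, ∀ f : Tor L → ℝ, IsGroundTwoMagnon L Δ lam2 f →
      0 < lam2 → lam2 ≤ 0.0513 * (2 * Real.pi / L) ^ 2 → lowGForm L Δ f ≤ a * etaEff L lam2 * Uunit L Δ f)
    (hKT2b : ∀ lam2 : ℝ, ∀ f : Tor L → ℝ, IsGroundTwoMagnon L Δ lam2 f →
      0 < lam2 → lam2 ≤ 0.0513 * (2 * Real.pi / L) ^ 2 →
        (ip L (resid L Δ f) (resid L Δ f)).re - polePart L Δ f - lowNormPart L Δ f
          ≤ b * etaEff L lam2 * (2 * eps1 L - Tplus L Δ f) * Uunit L Δ f) :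
    GM3Fibre L Δ :=
  gm3_of_hole2 L (by omega) hΔ0 hΔ1 c a b hH2
    (forall_ground_of_window_31 L hL hΔ0.le hΔ1 _ hreg)
    (trialGapAbs_of_window_31 L hL hΔ0.le hΔ1 hKT1)
    (lowShellGFormAbs_of_window_31 L hL hΔ0.le hΔ1 hKT2a)
    (offPoleTailAbs_of_window_31 L hL hΔ0.le hΔ1 hKT2b)

end Summit.HubbardSuperconductivity.HubbardSuperconductivity.Theorems.AnisotropyChord.Transfer.Fibre3

end
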